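import Literature.MathematicalPhysics.QuantumLattice.HubbardBlochModeVariational
import Literature.MathematicalPhysics.QuantumLattice.HubbardRingPerronFrobeniusProofs
import Literature.MathematicalPhysics.QuantumLattice.FreeFermionSectorEnergyDeviation
import HarnessLib

/-!
# An a-priori ceiling on the one-particle parity gap of doped Hubbard ground states: `PG = O(U) + O(1/L)`

Topic `MathematicalPhysics/QuantumLattice` (family `hubbard`); proof-only.  Written for route
`HubbardSuperconductivity/ParityGapRigidity`: its crux `GappedWindow` (stmt-HubbardSuperconductivity-2196)
posits a coupling `U > 0` and a doping `δ ∈ (0, 1/2)` with an `L`-uniform parity gap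
`E(N_L+1) + E(N_L-1) - 2E₀(N_L, S^z = 0) ≥ 2Δ > 0` (the Matveev–Larkin odd–even staircase) along the
even tori, and its kill criterion `NoUniformParityGap` (stmt-…-2198) denies this at every `(U, δ)`.
Neither is decidable today; this file proves the quantitative constraint both must respect.

**Theorem** (`parityGap_le_of_occupationFloor`). For `H = hubbardTorus 2 L 1 U` on an even torus
`(ℤ/Lℤ)²`, `L ≥ 3`, ANY real `U`, and the sector `(2n, S^z = 0)`, `2n ≤ L²`: for every occupation
floor `0 < a ≤ 1/2` with `aL² < n`,
`E(2n+1) + E(2n-1) - 2E₀(2n, 0) ≤ 4π/L + 2|U|/√a`.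

Proof (elementary, variational; no smallness of `U`, nothing about the ground state beyond
`Hψ = E₀ψ`).  Let `ψ` be a unit ground state of the sector and `n_k = ‖c_{k↑}ψ‖² ∈ [0, 1]` its
Bloch occupations, `Σ_k n_k = n`.  The trial states `c†_{k↑}ψ` (`2n+1` electrons) and `c_{k↑}ψ`
(`2n-1` electrons) have energies `≤ E₀ + ε_L(k) + |U|/√(1-n_k)` and `≤ E₀ - ε_L(k) + |U|/√n_k`
(`HubbardBlochModeVariational`: the kinetic cost of a Bloch mode is exactly `±ε_L(k)`, the
interaction costs at most `|U|·‖T_k^{(†)}ψ‖/‖c^{(†)}_kψ‖` with the dressed quasi-fermion `T_k`).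
DICHOTOMY: either some mode has `a ≤ n_k ≤ 1-a` — use it on both sides, the `ε_L(k)` cancel; or
every mode is nearly full (`> 1-a`) or nearly empty (`< a`), both kinds occur (`aL² < n ≤ L²/2`), and
for the nearly full mode `k*` of highest energy and the nearly empty mode `k∘` of lowest energy
`ε(k∘) ≤ ε(k*) + 4π/L` — otherwise the level strictly between them produced by the LEVEL SPACING of
the band (`exists_torusBand_lt_le_add`) could be neither; add at `k∘`, remove at `k*`.

* `parityGap_le_of_doping` — at doping `δ ∈ [0, 1)` (floor `a = (1-δ)/4`): for all even `L ≥ L₀(δ)`,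
  `PG(N_L; L) ≤ 4π/L + 4|U|/√(1-δ)`, `N_L = 2⌊(1-δ)L²/2⌋` — the exact `(U, δ, N_L)` format of the
  route's items;
* `uniformParityGap_le` — **a parity gap uniform in `L` is at most `2|U|/√(1-δ)`**: if `2Δ ≤ PG`
  along all even `L ≥ L₀` (the (PG) clause of `GappedWindow`, verbatim up to the coupling's name)
  then `Δ ≤ 2|U|/√(1-δ)`.

Reading (regime map).  The uniform parity gap of any window of the repulsive Hubbard model is
`O(U)` — at `U = 1/10` at most `≈ 0.28` whatever the mechanism — and it vanishes continuously at the
free point, matching the `U = 0` calibration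
(`Summits/…/Theorems/ParityGapRigidityZeroCouplingParityGap.lean`: open shells, `PG⁰ ≤ 0`
infinitely often).  The expected truth in the weak-coupling Kohn–Luttinger window is
`Δ ~ e^{-c/U²} ≪ U` (`Literature/Barriers/HubbardSuperconductivity/PerturbativeInvisibilityOfPairing`),
so the ceiling is far from saturated there; it is sharp in its `U`-linearity at strong coupling /
low density (Mott-type one-particle gaps are `~U`).  The tree's previous a-priori bound was
`|Δ_c| ≤ 108(2 + |U|)` (`abs_chargeGap_torus_le_of_window`).  No printed counterpart of this
`T = 0`, volume-uniform `O(U)` ceiling is known to the tree; it is an elementary consequence of the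
variational principle, the CAR and the absence of a bulk gap in the square-lattice band.

Sources: H. Tasaki, *Physics and Mathematics of Quantum Many-Body Systems* (2020) §2.1, §9.3;
K. A. Matveev, A. I. Larkin, PRL 78 (1997) 3749 (parity gap); E. H. Lieb, PRL 62 (1989) 1201 (the
`S^z = 0` sector).  Folklore finite-dimensional statements; no definitions, no named facts.

## Mathlib / tree search

Tree (REUSED): `szSector_groundState`, `exists_smul_unit`, `mem_szSector_two_mul_zero_iff`,
`sum_re_expect_momentumNumber_up`, `groundEnergy_succ_le_momentum`, `groundEnergy_pred_le_momentum`,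
`exists_torusBand_lt_le_add`, `torusBand_le_four`.  Mathlib: `Finset.exists_max_image`,
`Finset.exists_min_image`, `Finset.sum_lt_sum_of_nonempty`, `exists_nat_gt`.
-/

noncomputable section

namespace Literature.MathematicalPhysics.QuantumLattice

open Matrix Finset HubbardWave0 ThermodynamicLimit Literature.Probability.LatticeModels
open scoped ComplexOrder ComplexConjugate Matrix.Norms.L2Operator InnerProductSpace

/-! ### The parity-gap ceiling -/

section Ceiling

variable {L : ℕ} [NeZero L]

/-- **A-priori ceiling on the one-particle parity gap of Hubbard sector ground states.**
For the Hubbard model `H = hubbardTorus 2 L 1 U` on the even torus `(ℤ/Lℤ)²` (`L ≥ 3` even, any real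
`U`) and the sector `(2n, S^z = 0)` with `2n ≤ L²` electrons, and any occupation floor
`0 < a ≤ 1/2` with `a L² < n`:
`E(2n+1) + E(2n-1) - 2 E₀(2n, S^z=0) ≤ 4π/L + 2|U|/√a`.
Proof: take a unit sector ground state `ψ` and its Bloch occupations `n_k = ‖c_{k↑}ψ‖² ∈ [0,1]`,
`Σ_k n_k = n`.  Either some `n_k ∈ [a, 1-a]` — then add and remove an electron in the SAME mode:
the kinetic terms `±ε_L(k)` cancel and `E(2n±1) - E₀ ≤ |U|/√a` each
(`groundEnergy_succ_le_momentum`, `groundEnergy_pred_le_momentum`); or every mode is nearly full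
(`> 1-a`) or nearly empty (`< a`), both kinds occur (particle counting), and by the level spacing
`exists_torusBand_lt_le_add` a nearly full mode `k*` and a nearly empty mode `k∘` exist with
`ε(k∘) ≤ ε(k*) + 4π/L`: add at `k∘`, remove at `k*`.  No smallness of `U` and no property of the
ground state beyond the eigenvalue equation is used. [folklore] -/
theorem parityGap_le_of_occupationFloor (hL : 3 ≤ L) (hLe : Even L) (U : ℝ) {n : ℕ} {a : ℝ}
    (ha0 : 0 < a) (ha1 : a ≤ 1 / 2) (han : a * (L : ℝ) ^ 2 < n) (hn : 2 * n ≤ L ^ 2) :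
    groundEnergy (hubbardTorus 2 L 1 U) (2 * n + 1) + groundEnergy (hubbardTorus 2 L 1 U) (2 * n - 1) -
        2 * (hubbardTorus 2 L 1 U).minEnergyOn (szSector (Λ := FermionTorus 2 L) (2 * n) 0) ≤
      4 * Real.pi / L + 2 * |U| / Real.sqrt a := by
  classical
  set H := hubbardTorus 2 L 1 U with hH
  set E : ℝ := H.minEnergyOn (szSector (Λ := FermionTorus 2 L) (2 * n) 0) with hEdef
  have hLr : (0 : ℝ) < L := by exact_mod_cast (show 0 < L by omega)
  have hcardT : Fintype.card (TorusSite 2 L) = L ^ 2 := by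
    simp [TorusSite, ZMod.card, Fintype.card_fin]
  have hcardF : Fintype.card (FermionTorus 2 L) = L ^ 2 := by simp [FermionTorus, Fintype.card_fin]
  -- a unit ground state of the sector
  have hnL : n ≤ Fintype.card (FermionTorus 2 L) := by rw [hcardF]; omega
  obtain ⟨⟨ψ₀, hψ₀mem, hψ₀0, hψ₀E⟩, -⟩ := szSector_groundState (fermionTorusGraph 2 L) 1 U hnL
  obtain ⟨c, -, hc1⟩ := exists_smul_unit hψ₀0
  set ψ := c • ψ₀ with hψdef
  have hψmem : ψ ∈ szSector (Λ := FermionTorus 2 L) (2 * n) 0 := Submodule.smul_mem _ c hψ₀mem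
  have hψ₀E' : H *ᵥ ψ₀ = (E : ℂ) • ψ₀ := hψ₀E
  have hψE : H *ᵥ ψ = (E : ℂ) • ψ := by
    rw [hψdef, mulVec_smul, hψ₀E', smul_comm]
  have hNP : IsNParticle (2 * n) ψ := ((mem_szSector_iff _ _ _).1 hψmem).1
  have hsec : IsInSector n n ψ := (mem_szSector_two_mul_zero_iff n ψ).1 hψmem
  -- Bloch occupations
  set occ : TorusSite 2 L → ℝ := fun k =>
    (star (momentumAnnihilation k 0 *ᵥ ψ) ⬝ᵥ (momentumAnnihilation k 0 *ᵥ ψ)).re with hocc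
  have hocc0 : ∀ k, 0 ≤ occ k := fun k => by
    rw [hocc]; dsimp only; rw [← norm_toLp_sq]; positivity
  have hcre : ∀ k, (star (momentumCreation k 0 *ᵥ ψ) ⬝ᵥ (momentumCreation k 0 *ᵥ ψ)).re = 1 - occ k := by
    intro k
    have h := normSq_momentumCreation_add_normSq_momentumAnnihilation k ψ
    rw [hc1, Complex.one_re] at h
    rw [hocc]; dsimp only; linarith
  have hocc1 : ∀ k, occ k ≤ 1 := fun k => by
    have h0 : 0 ≤ (star (momentumCreation k 0 *ᵥ ψ) ⬝ᵥ (momentumCreation k 0 *ᵥ ψ)).re := by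
      rw [← norm_toLp_sq]; positivity
    linarith [hcre k]
  have hsum : ∑ k, occ k = n := by
    have h := sum_re_expect_momentumNumber_up (L := L) hsec
    rw [hc1, Complex.one_re, mul_one] at h
    rw [← h]
    refine Finset.sum_congr rfl fun k _ => ?_
    rw [hocc]; dsimp only; rw [star_dotProduct_momentumNumber_mulVec]
  -- norms in terms of occupations
  have hnormA : ∀ k, ‖(WithLp.toLp 2 (momentumAnnihilation k 0 *ᵥ ψ) :
      EuclideanSpace ℂ (Finset (Orb (FermionTorus 2 L))))‖ = Real.sqrt (occ k) := fun k => by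
    rw [← Real.sqrt_sq (norm_nonneg _), norm_toLp_sq]
  have hnormC : ∀ k, ‖(WithLp.toLp 2 (momentumCreation k 0 *ᵥ ψ) :
      EuclideanSpace ℂ (Finset (Orb (FermionTorus 2 L))))‖ = Real.sqrt (1 - occ k) := fun k => by
    rw [← Real.sqrt_sq (norm_nonneg _), norm_toLp_sq, hcre]
  have hneA : ∀ k, 0 < occ k → momentumAnnihilation k 0 *ᵥ ψ ≠ 0 := fun k hk h0 => by
    have : occ k = 0 := by rw [hocc]; dsimp only; rw [h0, dotProduct_zero, Complex.zero_re]
    linarith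
  have hneC : ∀ k, occ k < 1 → momentumCreation k 0 *ᵥ ψ ≠ 0 := fun k hk h0 => by
    have : 1 - occ k = 0 := by rw [← hcre k, h0, dotProduct_zero, Complex.zero_re]
    linarith
  -- the two one-particle bounds at modes with occupation floor `a`
  have hsqa : 0 < Real.sqrt a := Real.sqrt_pos.2 ha0
  have hplus : ∀ k, occ k ≤ 1 - a →
      groundEnergy H (2 * n + 1) ≤ E + torusBand L k + |U| / Real.sqrt a := by
    intro k hk
    have h := groundEnergy_succ_le_momentum hL U hNP hc1 hψE k (hneC k (by linarith))
    rw [hnormC] at h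
    have hmono : |U| / Real.sqrt (1 - occ k) ≤ |U| / Real.sqrt a :=
      div_le_div_of_nonneg_left (abs_nonneg _) hsqa (Real.sqrt_le_sqrt (by linarith))
    exact h.trans (by linarith)
  have hminus : ∀ k, a ≤ occ k →
      groundEnergy H (2 * n - 1) ≤ E - torusBand L k + |U| / Real.sqrt a := by
    intro k hk
    have h := groundEnergy_pred_le_momentum hL U hNP hc1 hψE k (hneA k (by linarith))
    rw [hnormA] at h
    have hmono : |U| / Real.sqrt (occ k) ≤ |U| / Real.sqrt a :=
      div_le_div_of_nonneg_left (abs_nonneg _) hsqa (Real.sqrt_le_sqrt hk)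
    exact h.trans (by linarith)
  have hπL : 0 ≤ 4 * (Real.pi / L) := by positivity
  suffices key : groundEnergy H (2 * n + 1) + groundEnergy H (2 * n - 1) - 2 * E ≤
      4 * (Real.pi / L) + 2 * (|U| / Real.sqrt a) by
    simpa only [mul_div_assoc] using key
  by_cases hA : ∃ k, a ≤ occ k ∧ occ k ≤ 1 - a
  · -- Case A: one mode in the middle — kinetic terms cancel
    obtain ⟨k, hk1, hk2⟩ := hA
    have h1 := hplus k hk2
    have h2 := hminus k hk1
    linarith
  · -- Case B: every mode nearly full or nearly empty
    push Not at hA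
    have hdich : ∀ k, occ k < a ∨ 1 - a < occ k := fun k => by
      by_cases h : a ≤ occ k
      · exact Or.inr (hA k h)
      · exact Or.inl (not_le.1 h)
    set Hs : Finset (TorusSite 2 L) := Finset.univ.filter fun k => 1 - a < occ k with hHs
    set Ls : Finset (TorusSite 2 L) := Finset.univ.filter fun k => occ k < a with hLs
    have hHne : Hs.Nonempty := by
      by_contra hemp
      rw [Finset.not_nonempty_iff_eq_empty, hHs, Finset.filter_eq_empty_iff] at hemp
      have hall : ∀ k, occ k < a := fun k =>
        (hdich k).resolve_right (hemp (Finset.mem_univ k))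
      have hlt : ∑ k, occ k < ∑ _k : TorusSite 2 L, a :=
        Finset.sum_lt_sum_of_nonempty ⟨0, Finset.mem_univ _⟩ fun k _ => hall k
      rw [hsum, Finset.sum_const, Finset.card_univ, hcardT, nsmul_eq_mul] at hlt
      push_cast at hlt
      linarith
    have hLne : Ls.Nonempty := by
      by_contra hemp
      rw [Finset.not_nonempty_iff_eq_empty, hLs, Finset.filter_eq_empty_iff] at hemp
      have hall : ∀ k, 1 - a < occ k := fun k =>
        (hdich k).resolve_left (hemp (Finset.mem_univ k))
      have hlt : ∑ _k : TorusSite 2 L, (1 - a) < ∑ k, occ k :=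
        Finset.sum_lt_sum_of_nonempty ⟨0, Finset.mem_univ _⟩ fun k _ => hall k
      rw [hsum, Finset.sum_const, Finset.card_univ, hcardT, nsmul_eq_mul] at hlt
      push_cast at hlt
      have h2n : (2 * n : ℝ) ≤ (L : ℝ) ^ 2 := by exact_mod_cast hn
      nlinarith
    obtain ⟨ks, hks, hksmax⟩ := Finset.exists_max_image Hs (torusBand L) hHne
    obtain ⟨ko, hko, hkomin⟩ := Finset.exists_min_image Ls (torusBand L) hLne
    have hksH : 1 - a < occ ks := (Finset.mem_filter.1 hks).2
    have hkoL : occ ko < a := (Finset.mem_filter.1 hko).2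
    -- the nearly empty mode is at most `4π/L` above the nearly full one
    have hgap : torusBand L ko ≤ torusBand L ks + 4 * (Real.pi / L) := by
      by_contra hcon
      push Not at hcon
      have hπL' : 0 < 4 * (Real.pi / L) := by positivity
      have hks4 : torusBand L ks < 4 := by
        have := torusBand_le_four L ko
        linarith
      obtain ⟨k', hk'1, hk'2⟩ := exists_torusBand_lt_le_add hLe ks hks4
      rw [mul_div_assoc] at hk'2
      rcases hdich k' with hk' | hk'
      · have : torusBand L ko ≤ torusBand L k' := hkomin k' (Finset.mem_filter.2 ⟨Finset.mem_univ _, hk'⟩)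
        linarith
      · have : torusBand L k' ≤ torusBand L ks := hksmax k' (Finset.mem_filter.2 ⟨Finset.mem_univ _, hk'⟩)
        linarith
    have h1 := hplus ko (by linarith)
    have h2 := hminus ks (by linarith)
    linarith

omit [NeZero L] in
/-- **The parity-gap ceiling at fixed doping.** For every real `U` and `0 ≤ δ < 1` there is `L₀`
such that for all even `L ≥ L₀` the Hubbard torus `hubbardTorus 2 L 1 U` at
`N_L = 2⌊(1-δ)L²/2⌋` electrons obeys
`E(N_L+1) + E(N_L-1) - 2 E₀(N_L, S^z = 0) ≤ 4π/L + 4|U|/√(1-δ)`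
(`parityGap_le_of_occupationFloor` with the floor `a = (1-δ)/4`).  So a parity gap that is
uniform in `L` is at most `2|U|/√(1-δ)`: the one-particle gap of any doped Hubbard ground state is
`O(U)`, uniformly in the volume. [folklore] -/
theorem parityGap_le_of_doping (U : ℝ) {δ : ℝ} (hδ0 : 0 ≤ δ) (hδ1 : δ < 1) :
    ∃ L₀ : ℕ, ∀ L : ℕ, L₀ ≤ L → Even L →
      groundEnergy (hubbardTorus 2 L 1 U) (2 * ⌊(1 - δ) * (L : ℝ) ^ 2 / 2⌋₊ + 1) +
          groundEnergy (hubbardTorus 2 L 1 U) (2 * ⌊(1 - δ) * (L : ℝ) ^ 2 / 2⌋₊ - 1) -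
        2 * (hubbardTorus 2 L 1 U).minEnergyOn
          (szSector (Λ := FermionTorus 2 L) (2 * ⌊(1 - δ) * (L : ℝ) ^ 2 / 2⌋₊) 0) ≤
      4 * Real.pi / L + 4 * |U| / Real.sqrt (1 - δ) := by
  have hx : 0 < 1 - δ := by linarith
  refine ⟨⌈4 / (1 - δ)⌉₊ + 3, fun L hL hLe => ?_⟩
  haveI : NeZero L := ⟨by omega⟩
  have hL3 : 3 ≤ L := by omega
  set n : ℕ := ⌊(1 - δ) * (L : ℝ) ^ 2 / 2⌋₊ with hn
  have hLr : (4 / (1 - δ) : ℝ) < L := by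
    have h1 : (4 / (1 - δ) : ℝ) ≤ ⌈4 / (1 - δ)⌉₊ := Nat.le_ceil _
    have h2 : ((⌈4 / (1 - δ)⌉₊ : ℕ) : ℝ) + 3 ≤ L := by exact_mod_cast hL
    linarith
  have hL1 : (1 : ℝ) ≤ L := by exact_mod_cast (show 1 ≤ L by omega)
  -- the floor `a = (1-δ)/4`
  have han : (1 - δ) / 4 * (L : ℝ) ^ 2 < n := by
    have h1 : (1 - δ) * (L : ℝ) ^ 2 / 2 < (n : ℝ) + 1 := Nat.lt_floor_add_one _
    have h4 : 4 < (1 - δ) * L := by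
      rw [div_lt_iff₀ hx] at hLr; linarith
    have h5 : (1 - δ) * L ≤ (1 - δ) * (L : ℝ) ^ 2 := by
      rw [sq]; exact mul_le_mul_of_nonneg_left (le_mul_of_one_le_left (by positivity) hL1) hx.le
    linarith
  have h2n : 2 * n ≤ L ^ 2 := by
    have h1 : (n : ℝ) ≤ (1 - δ) * (L : ℝ) ^ 2 / 2 := Nat.floor_le (by positivity)
    have h2 : (1 - δ) * (L : ℝ) ^ 2 / 2 ≤ (L : ℝ) ^ 2 / 2 := by
      apply div_le_div_of_nonneg_right _ two_pos.le
      have : (0:ℝ) ≤ (L : ℝ) ^ 2 := by positivity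
      nlinarith
    have h3 : (2 * n : ℝ) ≤ (L : ℝ) ^ 2 := by linarith
    exact_mod_cast h3
  have h := parityGap_le_of_occupationFloor hL3 hLe U (a := (1 - δ) / 4) (by positivity)
    (by linarith) han h2n
  have hsqrt : Real.sqrt ((1 - δ) / 4) = Real.sqrt (1 - δ) / 2 := by
    rw [Real.sqrt_div' _ (by norm_num : (0:ℝ) ≤ 4), show (4 : ℝ) = 2 ^ 2 by norm_num,
      Real.sqrt_sq (by norm_num : (0:ℝ) ≤ 2)]
  rw [hsqrt] at h
  have hs0 : 0 < Real.sqrt (1 - δ) := Real.sqrt_pos.2 hx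
  have : 2 * |U| / (Real.sqrt (1 - δ) / 2) = 4 * |U| / Real.sqrt (1 - δ) := by
    field_simp; ring
  linarith

omit [NeZero L] in
/-- **A uniform parity gap is at most `2|U|/√(1-δ)`.** If along the even sides `L ≥ L₀` the
Hubbard tori at doping `δ ∈ [0, 1)` have parity gap `≥ 2Δ` about the `(N_L, S^z = 0)` floor
(the parity-gap clause (PG) of route `ParityGapRigidity`'s `GappedWindow`, verbatim up to the name of
the coupling), then `Δ ≤ 2|U|/√(1-δ)` — in particular `Δ = O(U)`: no window of the repulsive Hubbard
model carries a parity gap larger than (a constant times) its coupling. [folklore] -/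
theorem uniformParityGap_le (U : ℝ) {δ : ℝ} (hδ0 : 0 ≤ δ) (hδ1 : δ < 1) {Δ : ℝ} {L₀ : ℕ}
    (h : ∀ L ≥ L₀, Even L → ∀ Hm, Hm = hubbardTorus 2 L 1 U →
      2 * Δ ≤ groundEnergy Hm (2 * ⌊(1 - δ) * (L : ℝ) ^ 2 / 2⌋₊ + 1) +
        groundEnergy Hm (2 * ⌊(1 - δ) * (L : ℝ) ^ 2 / 2⌋₊ - 1) -
          2 * Matrix.minEnergyOn Hm (szSector (2 * ⌊(1 - δ) * (L : ℝ) ^ 2 / 2⌋₊) 0)) :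
    Δ ≤ 2 * |U| / Real.sqrt (1 - δ) := by
  by_contra hcon
  push Not at hcon
  obtain ⟨L₁, hL₁⟩ := parityGap_le_of_doping U hδ0 hδ1
  -- the slack and an even side beating it
  have hPQ : 4 * |U| / Real.sqrt (1 - δ) = 2 * (2 * |U| / Real.sqrt (1 - δ)) := by ring
  set η : ℝ := 2 * Δ - 4 * |U| / Real.sqrt (1 - δ) with hη
  have hη0 : 0 < η := by rw [hη, hPQ]; linarith
  obtain ⟨M, hM⟩ := exists_nat_gt (4 * Real.pi / η)
  set L : ℕ := 2 * (L₀ + L₁ + M + 1) with hLdef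
  have hLe : Even L := ⟨L₀ + L₁ + M + 1, by rw [hLdef]; ring⟩
  have hL0 : L₀ ≤ L := by omega
  have hL1 : L₁ ≤ L := by omega
  have hLM : (M : ℝ) < L := by exact_mod_cast (show M < L by omega)
  have hLpos : (0 : ℝ) < L := by exact_mod_cast (show 0 < L by omega)
  have hπ : 4 * Real.pi / L < η := by
    rw [div_lt_iff₀ hLpos]
    have h1 : 4 * Real.pi / η < L := hM.trans hLM
    rw [div_lt_iff₀ hη0] at h1
    linarith
  have hlow := h L hL0 hLe _ rfl
  have hup := hL₁ L hL1 hLe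
  linarith

end Ceiling



end Literature.MathematicalPhysics.QuantumLattice

end
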